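import Mathlib
import HarnessLib
import Summits.ValiantsHypothesis.Statement
import Literature.Computability.AlgebraicComplexity.BLMW11FormulasWeaklySkew

/-!
# DefinabilityGap — the quasi-polynomial rung of the wall `Bws` (support for `KIPlantedHitting`, item `stmt-ValiantsHypothesis-23547`)

Support lemma for route `route-ValiantsHypothesis-DefinabilityGap` (decomp-valiant lens 5, gen 2). In the planned glued split of
the crux `KIPlantedHitting` at `VP_ws`, the second child is the declared-residual wall
`CollapseToVPws : VP ℂ = VNP ℂ → (every VNP family has p-bounded weakly-skew complexity)`. Its QUASI-POLYNOMIAL rung is a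
theorem — the printed remark "replacing polynomial by quasipolynomial bounds, `VP_e`, `VP_ws`, `VP` coincide" (BLMW 2011
§9.1; VSBR depth reduction + BCS Thm. 21.33), in the tree as `isQPBounded_wsComplexity_iff_isQPBounded_complexity`:

* `isQPBounded_wsComplexity_of_isVPFamily` — `VP ⊆ VQP_ws` (unconditional): a `VP` family has qp-bounded `L_ws`;
* `isQPBounded_wsComplexity_of_isVNPFamily_of_collapse` — IF `VP ℂ = VNP ℂ` THEN every `VNP` family (variables `Fin (v n)`)
  has qp-bounded `L_ws` (the rung `CollapseToVQPws` of the lens file, proved).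

The gap between this rung and the wall is exactly "quasi-polynomial → polynomial weakly-skew size for `VNP = VP` families",
i.e. beating the depth-reduction exponent `n^{O(log n)}` using the collapse.
-/

noncomputable section

open MvPolynomial
open Literature.Computability.AlgebraicComplexity

namespace Summit.ValiantsHypothesis.ValiantsHypothesis.Theorems.DefinabilityGapVQPwsRung

/-- **`VP ⊆ VQP_ws` (kernel, unconditional)**: a `VP` family over `ℂ` in variables `Fin (v n)` has quasi-polynomially
bounded weakly-skew complexity. [cite: BurgisserEtAl2011, §9.1 (quasipolynomial bounds: the classes coincide)] -/
theorem isQPBounded_wsComplexity_of_isVPFamily {v : ℕ → ℕ} {f : ∀ n, MvPolynomial (Fin (v n)) ℂ}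
    (hf : IsVPFamily f) : IsQPBounded fun n => wsComplexity (f n) :=
  (isQPBounded_wsComplexity_iff_isQPBounded_complexity hf.1).2 (IsPBounded.isQPBounded hf.2)

/-- **The quasi-polynomial rung of `Bws` (kernel)**: if `VP ℂ = VNP ℂ` then every `VNP` family over `ℂ` in variables
`Fin (v n)` has quasi-polynomially bounded weakly-skew complexity (`VNP = VP ⊆ VQP_ws`).
[cite: BurgisserEtAl2011, §9.1 (quasipolynomial bounds: the classes coincide)] -/
theorem isQPBounded_wsComplexity_of_isVNPFamily_of_collapse (hEq : VP ℂ = VNP ℂ) {v : ℕ → ℕ}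
    {f : ∀ n, MvPolynomial (Fin (v n)) ℂ} (hf : IsVNPFamily f) :
    IsQPBounded fun n => wsComplexity (f n) := by
  have hVNP : PolyFamily.ofFintype f ∈ VNP ℂ := (mem_VNP_ofFintype_iff_holds f).2 hf
  rw [← hEq] at hVNP
  exact isQPBounded_wsComplexity_of_isVPFamily ((mem_VP_ofFintype_iff_holds f).1 hVNP)

/-- The rung sits below the wall: p-bounded `L_ws` for `VNP` families under the collapse (the wall `CollapseToVPws`)
trivially gives qp-bounded `L_ws`. [cite: Burgisser2000, Def. 2.26] -/
theorem isQPBounded_wsComplexity_of_isPBounded {σ : ℕ → Type*} {f : ∀ n, MvPolynomial (σ n) ℂ}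
    (h : IsPBounded fun n => wsComplexity (f n)) : IsQPBounded fun n => wsComplexity (f n) :=
  IsPBounded.isQPBounded h

end Summit.ValiantsHypothesis.ValiantsHypothesis.Theorems.DefinabilityGapVQPwsRung

end
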